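import Mathlib.Analysis.SpecialFunctions.Pow.Real
import Mathlib.Data.Set.Card
import Literature.Computability.Complexity.CircuitClasses
import Literature.Computability.MetaComplexity.CircuitMagnification
import HarnessLib

/-!
# Chen–Jin–Williams 2019: hardness magnification for ALL sparse `NP` languages, circuit item
# (Theorem 1.1, item 1, `C = NP`) and its printed converse, as named facts

Citation header. L. Chen, C. Jin, R. R. Williams, *Hardness Magnification for all Sparse NP
Languages*, FOCS 2019, 1240–1255, doi:10.1109/FOCS.2019.00077 [bib: `ChenJinWilliams2019`]; full
version ECCC TR19-118 (read: `lit read https://eccc.weizmann.ac.il/report/2019/118/download`, held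
key `paper:url-5c604605311c`; theorem numbering identical). Printed (TR19-118 p. 3–4, verbatim):
*"Theorem 1.1. Let `C` be any complexity class such that `∃·C = C` (e.g., `C = NP`, `MA`, or `AM`).
If there is an `ε > 0` and a family of languages `{L_β}` (indexed over `β ∈ (0,1)`) such that `L_β`
is a `2^{n^β}`-sparse language in `C` and for all `β`: 1. `L_β ∉ Circuit[n^{1+ε}]`, then
`C ⊄ Circuit[n^k]` for all `k`. … Moreover, the converse of each item above also holds, except for
the last two."* Conventions (p. 9, verbatim): *"We say a language `L` is `f(n)`-sparse if
`|L_n| ≤ f(n)`, where `L_n = L ∩ {0,1}ⁿ`"*; circuits are fan-in-two Boolean circuits (Def. 2.1),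
i.e. the tree's `B₂` basis up to a constant factor. Proof in print (§1.3 p. 7, §4): a
Turing-kernelization of a `2^t`-sparse `NP` language to an auxiliary `NP` function `H` on `O(t)`
input bits via linear hashing (Spielman codes + expander walks); under `NP ⊂ Circuit[n^k]`, `H` has
`O(t^k)`-size circuits and `L_n` is an AND of `n` copies of `H` on parities, of total size
`Õ(n + n·t^k) < n^{1+ε}` for `β = ε/(2k)`.

## What is vendored (typed, not proved)

* `thm11_circuit_NP` — item 1 for `C = NP`, in the tree's vocabulary (`SIZE` = `B₂`-circuit
  families with the size bound at EVERY length, `CircuitClasses.lean`; `Nondeterministic.NP`):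
  `∀ ε > 0, (∀ β ∈ (0,1), ∃ L ∈ NP, L is 2^{n^β}-sparse ∧ ∀ c, L ∉ SIZE(c·⌈n^{1+ε}⌉ + c)) →
   ∀ k, ∃ L ∈ NP, ∀ c, L ∉ SIZE(c·n^k + c)`.
* `thm11_circuit_NP_converse` — the printed converse ("Moreover, the converse … also holds"):
  `(∀ k, ∃ L ∈ NP, ∀ c, L ∉ SIZE(c·n^k + c)) → ∃ ε > 0, ∀ β ∈ (0,1), ∃ L ∈ NP, 2^{n^β}-sparse ∧
   ∀ c, L ∉ SIZE(c·⌈n^{1+ε}⌉ + c)`.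
  Hence in print the hypothesis of item 1 is EQUIVALENT to `NP ⊄ SIZE[n^k] ∀ k`: a census of
  "threshold vs known bound" must record this row as an equivalence, not a gap to be closed by a
  slightly better bound.

Why the renderings are implied by (and not stronger than) the printed statements. (i) Robust size
bounds with PER-LANGUAGE constants: "`L ∉ Circuit[s]`" in print is an infinitely-often lower bound
(`L` has no `s`-size circuits on all large lengths; the everywhere reading is degenerate at `n = 0`,
cf. `MCSPSize_not_mem_SIZE_zero` in `CircuitMagnification.lean`). `∀ c, L ∉ SIZE(c·⌈n^{1+ε}⌉ + c)`
says "the circuit complexity of `L` is not `O(n^{1+ε})`, finitely many lengths hard-wired into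
`+ c`"; it implies the printed `L ∉ Circuit[n^{1+ε/2}]` (an eventually-`n^{1+ε/2}` family patched
at finitely many lengths has size `≤ 1·⌈n^{1+ε}⌉ + c` for some `c`), so the printed theorem at
`ε/2` with the same family gives `NP ⊄ Circuit[n^{k+1}]`, i.e. some `L ∈ NP` without eventual
`n^{k+1}`-size circuits, whence `∀ c, L ∉ SIZE(c·n^k + c)` (`c·n^k + c ≤ n^{k+1}` for large `n`).
Conversely, `∀ k, ∃ L ∈ NP, ∀ c, L ∉ SIZE(c·n^k + c)` implies the printed `NP ⊄ Circuit[n^k] ∀ k`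
(patching), and the printed converse at `ε` yields `SparseNPHardAt (ε/2)` by the same absorption.
The constants must be per-language: with ONE additive constant, `¬ NP ⊆ SIZE(n^k + k)` already
follows from a finite language in `P` with a single Shannon-hard slice, a triviality. The `∀ c` /
`+ c` form also keeps every size class INHABITED at every length (`zero_mem_SIZE_superlinearBound`,
`zero_mem_SIZE_polyBound`), so "`L ∉ SIZE(…)`" is a genuine lower bound, never a vacuity.
(ii) The family `{L_β}` indexed by `β` is rendered `∀ β ∈ (0,1), ∃ L, …` (choice). (iii) Basis
constants (`B₂` vs. `{∧,∨,¬}` fan-in two) are absorbed by `∀ c` and the `ε/2` slack.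
(iv) Sparsity `|L_n| ≤ 2^{n^β}` is rendered with `⌊2^{n^β}⌋₊` on the honest finite cardinality
`Set.ncard` of the slice (slices are finite).

Not reproduced: items 2–7 (formula, branching-program, `AC_d[m]`, `TC_d` models — the tree's
`FORMULA` class is not yet inhabited, and it has no BP/`U₂-Formula-⊕` classes), Theorems 1.2–1.5
and 1.8 (uniform RAM-model algorithms with advice: the tree's time classes are multitape-TM based,
and at the `Õ(n)` / `n^{1+ε}` scale the RAM/TM distinction changes the threshold), Theorem 1.6
(search-MCSP / MKtP for `C ∈ {⊕P, PP, PSPACE, EXP}`), the zero-error heuristics of Thms 1.9–1.10,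
and all proofs.
-/

noncomputable section

namespace Literature.Computability.MetaComplexity.ChenJinWilliams2019

open Complexity Complexity.Nondeterministic

/-! ### Sparsity and the size bounds -/

/-- `L` is `f(n)`-sparse: `|L ∩ {0,1}ⁿ| ≤ f(n)` for every `n` (Chen–Jin–Williams 2019, §2, p. 9:
*"We say a language `L` is `f(n)`-sparse if `|L_n| ≤ f(n)`, where `L_n = L ∩ {0,1}ⁿ`"*), with the
slice cardinality as `Set.ncard` (slices are finite: `Literature.Barriers.PneNP.finite_slice`; same shape as
`Literature.Barriers.PneNP.IsSparseLanguage`, which fixes `f = n^c + c`). [cite: ChenJinWilliams2019, §2 (p. 9)] -/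
def IsSparse (f : ℕ → ℕ) (L : Language Bool) : Prop :=
  ∀ n : ℕ, {x : List Bool | x ∈ L ∧ x.length = n}.ncard ≤ f n

/-- The sparsity function `n ↦ ⌊2^{n^β}⌋` of the printed "`2^{n^β}`-sparse". [cite: ChenJinWilliams2019, Thm. 1.1] -/
def expSparsity (β : ℝ) : ℕ → ℕ := fun n => ⌊(2 : ℝ) ^ ((n : ℝ) ^ β)⌋₊

/-- The robust super-linear size bound `n ↦ c·⌈n^{1+ε}⌉ + c` rendering "`Circuit[n^{1+ε}]`"
(module docstring, (i)). [cite: ChenJinWilliams2019, Thm. 1.1] -/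
def superlinearBound (ε : ℝ) (c : ℕ) : ℕ → ℕ := fun n => c * ⌈(n : ℝ) ^ (1 + ε)⌉₊ + c

/-- The polynomial size bound `n ↦ c·n^k + c` rendering "`Circuit[n^k]`" up to the (per-language)
constant `c` (module docstring, (i)). [cite: ChenJinWilliams2019, Thm. 1.1] -/
def polyBound (k c : ℕ) : ℕ → ℕ := fun n => c * n ^ k + c

/-- The empty language is `f`-sparse for every `f`. [folklore] -/
theorem isSparse_zero (f : ℕ → ℕ) : IsSparse f (0 : Language Bool) := fun n => by
  have : {x : List Bool | x ∈ (0 : Language Bool) ∧ x.length = n} = ∅ :=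
    Set.eq_empty_of_forall_notMem fun x hx => hx.1
  rw [this, Set.ncard_empty]
  exact Nat.zero_le _

/-- Sparsity is monotone in the bound. [folklore] -/
theorem IsSparse.mono {f g : ℕ → ℕ} (h : ∀ n, f n ≤ g n) {L : Language Bool} (hL : IsSparse f L) :
    IsSparse g L := fun n => (hL n).trans (h n)

/-- `c ≤ c·⌈n^{1+ε}⌉ + c`. [folklore] -/
theorem le_superlinearBound (ε : ℝ) (c n : ℕ) : c ≤ superlinearBound ε c n :=
  Nat.le_add_left c _

/-- `c ≤ c·n^k + c`. [folklore] -/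
theorem le_polyBound (k c n : ℕ) : c ≤ polyBound k c n :=
  Nat.le_add_left c _

/-- INHABITEDNESS of the hypothesis' size classes: for `1 ≤ c` the empty language lies in
`SIZE(c·⌈n^{1+ε}⌉ + c)` at every length (one constant gate), so `L ∉ SIZE(superlinearBound ε c)`
is a genuine circuit lower bound and not membership failure in an empty class. [folklore] -/
theorem zero_mem_SIZE_superlinearBound (ε : ℝ) {c : ℕ} (hc : 1 ≤ c) :
    (0 : Language Bool) ∈ SIZE (superlinearBound ε c) := by
  refine ⟨fun n => Circuit.const (Fin n) false, fun n => ⟨?_, ?_⟩, fun x => ?_⟩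
  · intro g hg
    have hg' : g = ⟨0, fun _ => false, Fin.elim0⟩ := List.mem_singleton.1 hg
    subst hg'
    show (0 : ℕ) ≤ 2
    exact Nat.zero_le 2
  · exact hc.trans (le_superlinearBound ε c n)
  · exact ((Set.notMem_iff_boolIndicator (0 : Language Bool) x).1 (Language.notMem_zero x)).symm

/-- Likewise the full language lies in `SIZE(c·⌈n^{1+ε}⌉ + c)` for `1 ≤ c`. [folklore] -/
theorem univ_mem_SIZE_superlinearBound (ε : ℝ) {c : ℕ} (hc : 1 ≤ c) :
    (Set.univ : Language Bool) ∈ SIZE (superlinearBound ε c) := by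
  refine ⟨fun n => Circuit.const (Fin n) true, fun n => ⟨?_, ?_⟩, fun x => ?_⟩
  · intro g hg
    have hg' : g = ⟨0, fun _ => true, Fin.elim0⟩ := List.mem_singleton.1 hg
    subst hg'
    show (0 : ℕ) ≤ 2
    exact Nat.zero_le 2
  · exact hc.trans (le_superlinearBound ε c n)
  · exact ((Set.mem_iff_boolIndicator (Set.univ : Language Bool) x).1 (Set.mem_univ x)).symm

/-- INHABITEDNESS of the conclusion's size classes: the empty language lies in `SIZE(c·n^k + c)`
for `1 ≤ c`. [folklore] -/
theorem zero_mem_SIZE_polyBound (k : ℕ) {c : ℕ} (hc : 1 ≤ c) :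
    (0 : Language Bool) ∈ SIZE (polyBound k c) := by
  refine ⟨fun n => Circuit.const (Fin n) false, fun n => ⟨?_, ?_⟩, fun x => ?_⟩
  · intro g hg
    have hg' : g = ⟨0, fun _ => false, Fin.elim0⟩ := List.mem_singleton.1 hg
    subst hg'
    show (0 : ℕ) ≤ 2
    exact Nat.zero_le 2
  · exact hc.trans (le_polyBound k c n)
  · exact ((Set.notMem_iff_boolIndicator (0 : Language Bool) x).1 (Language.notMem_zero x)).symm

/-- The size classes `SIZE(c·⌈n^{1+ε}⌉ + c)` grow with `c`. [folklore] -/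
theorem SIZE_superlinearBound_mono (ε : ℝ) {c c' : ℕ} (h : c ≤ c') :
    SIZE (superlinearBound ε c) ⊆ SIZE (superlinearBound ε c') :=
  SIZE_mono fun _ => Nat.add_le_add (Nat.mul_le_mul_right _ h) h

/-! ### The hypothesis of item 1 and the named facts -/

/-- The magnification HYPOTHESIS of Thm. 1.1 item 1 at a fixed `ε` (for `C = NP`): for every
`β ∈ (0,1)` some `2^{n^β}`-sparse `NP` language has circuit complexity not `O(n^{1+ε})`.
[cite: ChenJinWilliams2019, Thm. 1.1 (item 1)] -/
def SparseNPHardAt (ε : ℝ) : Prop :=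
  ∀ β : ℝ, 0 < β → β < 1 →
    ∃ L : Language Bool, L ∈ NP ∧ IsSparse (expSparsity β) L ∧
      ∀ c : ℕ, L ∉ SIZE (superlinearBound ε c)

/-- "`NP ⊄ Circuit[n^k]` for all `k`", rendered robustly: for every `k` some `NP` language has
circuit complexity not `O(n^k)` — `∃ L ∈ NP, ∀ c, L ∉ SIZE(c·n^k + c)`. (The constant MUST be
per-language: with a uniform additive constant, `¬ NP ⊆ SIZE(n^k + k)` would already follow from a
single FINITE language in `P` with one Shannon-hard slice, and the fact would be a triviality.)
[cite: ChenJinWilliams2019, Thm. 1.1] -/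
def NPNotInFixedPolySize : Prop :=
  ∀ k : ℕ, ∃ L : Language Bool, L ∈ NP ∧ ∀ c : ℕ, L ∉ SIZE (polyBound k c)

/-- **Chen–Jin–Williams 2019, Theorem 1.1, item 1, for `C = NP` — hardness magnification for all
sparse `NP` languages against `n^{1+ε}`-size circuits.** Printed (TR19-118 p. 3–4): *"If there is
an `ε > 0` and a family of languages `{L_β}` (indexed over `β ∈ (0,1)`) such that `L_β` is a
`2^{n^β}`-sparse language in `C` and for all `β`: 1. `L_β ∉ Circuit[n^{1+ε}]`, then
`C ⊄ Circuit[n^k]` for all `k`."* Rendering and why it is implied by print: module docstring (i)–(iv).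
[cite: ChenJinWilliams2019, Thm. 1.1 (item 1, C = NP), TR19-118 pp. 3–4] -/
def thm11_circuit_NP : Prop :=
  ∀ ε : ℝ, 0 < ε → SparseNPHardAt ε → NPNotInFixedPolySize

/-- **Chen–Jin–Williams 2019, Theorem 1.1, converse of item 1, for `C = NP`.** Printed (TR19-118
p. 4): *"Moreover, the converse of each item above also holds, except for the last two."* (items 6–7
are the `AC_d[m]` and `TC_d` items; item 1 is among those whose converse holds — by padding an `NP`
language without `n^k`-size circuits down to a `2^{n^β}`-sparse one). With `thm11_circuit_NP` this
makes the sparse-language hypothesis EQUIVALENT to `NP ⊄ SIZE[n^k] ∀ k`.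
[cite: ChenJinWilliams2019, Thm. 1.1 ("Moreover, the converse … also holds"), TR19-118 p. 4] -/
def thm11_circuit_NP_converse : Prop :=
  NPNotInFixedPolySize → ∃ ε : ℝ, 0 < ε ∧ SparseNPHardAt ε

/-- The two printed directions together: the item-1 hypothesis (at some `ε > 0`) is equivalent to
`NP ⊄ SIZE[n^k] ∀ k`. [cite: ChenJinWilliams2019, Thm. 1.1 (item 1 and its converse)] -/
theorem sparseNPHard_iff (h : thm11_circuit_NP) (h' : thm11_circuit_NP_converse) :
    (∃ ε : ℝ, 0 < ε ∧ SparseNPHardAt ε) ↔ NPNotInFixedPolySize :=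
  ⟨fun ⟨ε, hε, hH⟩ => h ε hε hH, h'⟩

/-- Monotonicity in `ε`: hardness against `n^{1+ε}` implies hardness against `n^{1+ε'}` for
`ε' ≤ ε` (the size classes shrink). [folklore] -/
theorem SparseNPHardAt.mono {ε ε' : ℝ} (hε' : 0 ≤ ε') (h : ε' ≤ ε) (hH : SparseNPHardAt ε) :
    SparseNPHardAt ε' := by
  intro β hβ0 hβ1
  obtain ⟨L, hNP, hsp, hL⟩ := hH β hβ0 hβ1
  refine ⟨L, hNP, hsp, fun c hc => hL c (SIZE_mono (fun n => ?_) hc)⟩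
  -- `c·⌈n^{1+ε'}⌉ + c ≤ c·⌈n^{1+ε}⌉ + c`
  refine Nat.add_le_add (Nat.mul_le_mul_left c (Nat.ceil_le_ceil ?_)) le_rfl
  rcases Nat.eq_zero_or_pos n with hn | hn
  · subst hn
    have h1 : (1 : ℝ) + ε' ≠ 0 := by linarith
    have h2 : (1 : ℝ) + ε ≠ 0 := by linarith
    simp [Real.zero_rpow h1, Real.zero_rpow h2]
  · exact Real.rpow_le_rpow_of_exponent_le (by exact_mod_cast hn) (by linarith)

end Literature.Computability.MetaComplexity.ChenJinWilliams2019

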